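import Literature.NumberTheory.Sieve.ParityWave0OddLogChowlaDefs
import Literature.NumberTheory.Sieve.LinearEquationsInPrimesTransference
import Mathlib.NumberTheory.Primorial
import HarnessLib

/-!
# Odd-order logarithmic Chowla (Tao–Teräväinen 2018): lemmas for the comparison theorem

Topic `Literature/NumberTheory/Sieve`; fourth support file towards the named fact
`Literature.NumberTheory.Sieve.liouville_logCorrelation_isLittleO_of_odd` (**parity.S22**,
`ParityWave0.lean`): T. Tao, J. Teräväinen, *Odd order cases of the logarithmically averaged
Chowla conjecture*, J. Théor. Nombres Bordeaux 30 (2018), 997–1015 (arXiv:1710.02112), §5,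
proof of **Theorem 3.2** (comparison of `𝔼^{log}_{2^m < p ≤ 2^{m+1}} f_x(ap)` with
`𝔼^{log}_{2^m < n ≤ 2^{m+1}, (n,W)=1} f_x(an)`). Everything here is PROVED; no definitions, no
named facts. The elementary steps of that proof, isolated:

* ratios of sums: `OddLogChowla.abs_weightedAvg_sub_le` (replacing the weights `1/p` by
  `Λ(p)/(p · m log 2)`, "Because `Λ(p) = log(2^m) + O(1)` …"), `OddLogChowla.abs_ratio_perturb_le`;
* `OddLogChowla.abs_sum_Ioc_mul_le_of_antitone` — Abel's inequality ("By summation by parts");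
* `OddLogChowla.sum_filter_coprime_Ioc_eq` — "Partitioning into residue classes modulo `W`":
  the integers of `(s, t]` coprime to `W` are the `n = Wd + b`, `b = n mod W` coprime to `W`,
  `(s-b)/W < d ≤ (t-b)/W`; `OddLogChowla.card_Ioc_div_ge`; `OddLogChowla.coprime_primorial_of_lt`;
* the `W`-tricked von Mangoldt weight of the tree (`Literature.NumberTheory.Sieve.vonMangoldtW`,
  Green–Tao 2010, (5.1)): `OddLogChowla.vonMangoldtPrime_eq_mul_vonMangoldtW`
  (`Λ'(n) = (W/φ(W)) Λ'_{n mod W, W}(⌊n/W⌋)`), `OddLogChowla.sum_abs_vonMangoldtW_sub_one_le`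
  (`Λ' ≤ Λ ≤ log` through Mathlib's `ArithmeticFunction.vonMangoldt_le_log`);
* `OddLogChowla.abs_errorSum_le` — the key estimate: if every flat sum
  `∑_{d ≤ H} (Λ'_{b,W}(d) - 1) F(Wd+b)` with `(s-b)/W ≤ H ≤ (2s-b)/W` has size `≤ τ s/W`, then
  `|∑_{n ∈ (s,2s], (n,W)=1} F(n)(Λ'_{b(n),W}(d(n)) - 1)/n| ≤ 8τ ∑_{n ∈ (s,2s], (n,W)=1} 1/n`
  (Abel in `n`, residues, and `∑_{(n,W)=1} 1/n ≥ #residues/(4W)`; no lower bound for `φ(W)` is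
  needed because both sides are sums over the same residues).

## References
* T. Tao, J. Teräväinen, J. Théor. Nombres Bordeaux 30 (2018), §5, proof of Theorem 3.2 (first
  five displays). [TaoTeravainenJTNB2018]
* B. Green, T. Tao, Ann. of Math. 171 (2010), (5.1) (the `W`-trick). [GreenTao2010]
-/

noncomputable section

open Finset

namespace Literature.NumberTheory.Sieve

namespace OddLogChowla

/-! ### Elementary inequalities for ratios of sums -/

/-- **Perturbing the weights of an average**: if `v_p ≥ 0` with `∑ v > 0`, `1 ≤ ω_p ≤ 1 + η`
and `|F| ≤ 1`, then the `ωv`-weighted and the `v`-weighted averages of `F` differ by at most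
`2η`. [folklore] -/
theorem abs_weightedAvg_sub_le {ι : Type*} (P : Finset ι) {v ω F : ι → ℝ} {η : ℝ} (hη : 0 ≤ η)
    (hv : ∀ p ∈ P, 0 ≤ v p) (hV : 0 < ∑ p ∈ P, v p) (hω : ∀ p ∈ P, 1 ≤ ω p ∧ ω p ≤ 1 + η)
    (hF : ∀ p ∈ P, |F p| ≤ 1) :
    |(∑ p ∈ P, F p * (ω p * v p)) / (∑ p ∈ P, ω p * v p) -
      (∑ p ∈ P, F p * v p) / ∑ p ∈ P, v p| ≤ 2 * η := by
  set V := ∑ p ∈ P, v p with hVdef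
  set Vω := ∑ p ∈ P, ω p * v p with hVωdef
  have hVω : V ≤ Vω := Finset.sum_le_sum fun p hp => by
    have := (hω p hp).1; have := hv p hp; nlinarith
  have hVω' : Vω ≤ (1 + η) * V := by
    rw [hVdef, Finset.mul_sum]
    exact Finset.sum_le_sum fun p hp => by
      have := (hω p hp).2; have := hv p hp; nlinarith
  have hVω0 : 0 < Vω := lt_of_lt_of_le hV hVω
  rw [div_sub_div _ _ hVω0.ne' hV.ne', abs_div, abs_mul, abs_of_pos hVω0, abs_of_pos hV,
    div_le_iff₀ (by positivity)]
  -- numerator: `V ∑ F(ω-1)v - (Vω - V) ∑ F v`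
  have hnum : (∑ p ∈ P, F p * (ω p * v p)) * V - Vω * ∑ p ∈ P, F p * v p =
      V * ∑ p ∈ P, F p * ((ω p - 1) * v p) - (Vω - V) * ∑ p ∈ P, F p * v p := by
    have : ∑ p ∈ P, F p * ((ω p - 1) * v p) = ∑ p ∈ P, F p * (ω p * v p) - ∑ p ∈ P, F p * v p := by
      rw [← Finset.sum_sub_distrib]; exact Finset.sum_congr rfl fun p _ => by ring
    rw [this]; ring
  have h1 : |∑ p ∈ P, F p * ((ω p - 1) * v p)| ≤ η * V := by
    refine (Finset.abs_sum_le_sum_abs _ _).trans ?_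
    rw [hVdef, Finset.mul_sum]
    refine Finset.sum_le_sum fun p hp => ?_
    rw [abs_mul, abs_mul, abs_of_nonneg (by linarith [(hω p hp).1] : (0:ℝ) ≤ ω p - 1),
      abs_of_nonneg (hv p hp)]
    have h1' := (hω p hp).1; have h2' := (hω p hp).2; have h3' := hv p hp
    have h4' : 0 ≤ (ω p - 1) * v p := mul_nonneg (by linarith) h3'
    calc |F p| * ((ω p - 1) * v p) ≤ 1 * ((ω p - 1) * v p) :=
          mul_le_mul_of_nonneg_right (hF p hp) h4'
      _ ≤ η * v p := by nlinarith
  have h2 : |∑ p ∈ P, F p * v p| ≤ V := by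
    refine (Finset.abs_sum_le_sum_abs _ _).trans (Finset.sum_le_sum fun p hp => ?_)
    rw [abs_mul, abs_of_nonneg (hv p hp)]
    exact (mul_le_mul_of_nonneg_right (hF p hp) (hv p hp)).trans (by rw [one_mul])
  rw [hnum]
  calc |V * ∑ p ∈ P, F p * ((ω p - 1) * v p) - (Vω - V) * ∑ p ∈ P, F p * v p|
      ≤ |V * ∑ p ∈ P, F p * ((ω p - 1) * v p)| + |(Vω - V) * ∑ p ∈ P, F p * v p| :=
        abs_sub _ _
    _ ≤ V * (η * V) + (η * V) * V := by
        rw [abs_mul, abs_mul, abs_of_pos hV, abs_of_nonneg (by linarith : (0:ℝ) ≤ Vω - V)]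
        exact add_le_add (mul_le_mul_of_nonneg_left h1 hV.le)
          (mul_le_mul (by linarith) h2 (abs_nonneg _) (by positivity))
    _ ≤ 2 * η * (Vω * V) := by nlinarith

/-- **Perturbing a ratio**: if `|N| ≤ D`, `D > 0`, `|E| ≤ δ D`, `|E'| ≤ δ D` and `δ ≤ 1/2`, then
`|(N + E)/(D + E') - N/D| ≤ 4δ`. [folklore] -/
theorem abs_ratio_perturb_le {N D E E' δ : ℝ} (hD : 0 < D) (hN : |N| ≤ D) (hE : |E| ≤ δ * D)
    (hE' : |E'| ≤ δ * D) (hδ : δ ≤ 1 / 2) :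
    |(N + E) / (D + E') - N / D| ≤ 4 * δ := by
  have hδ0 : 0 ≤ δ := by
    have := (abs_nonneg E).trans hE
    nlinarith
  have hE'l : -(δ * D) ≤ E' := (abs_le.mp hE').1
  have hD' : D / 2 ≤ D + E' := by nlinarith
  have hD'0 : 0 < D + E' := by linarith
  rw [div_sub_div _ _ hD'0.ne' hD.ne', abs_div, abs_mul, abs_of_pos hD'0, abs_of_pos hD,
    div_le_iff₀ (by positivity)]
  have hnum : (N + E) * D - (D + E') * N = D * E - N * E' := by ring
  rw [hnum]
  calc |D * E - N * E'| ≤ |D * E| + |N * E'| := abs_sub _ _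
    _ ≤ D * (δ * D) + D * (δ * D) := by
        rw [abs_mul, abs_mul, abs_of_pos hD]
        exact add_le_add (mul_le_mul_of_nonneg_left hE hD.le)
          (mul_le_mul hN hE' (abs_nonneg _) hD.le)
    _ = 4 * δ * (D / 2 * D) := by ring
    _ ≤ 4 * δ * ((D + E') * D) := by
        refine mul_le_mul_of_nonneg_left ?_ (by positivity)
        exact mul_le_mul_of_nonneg_right hD' hD.le

/-! ### Abel summation with a nonnegative antitone weight -/

/-- **Abel's inequality**: for a weight `u` that is nonnegative and antitone on `(D₀, D₁]` and any
`c`, `|∑_{D₀ < i ≤ D₁} u(i) c(i)| ≤ u(D₀+1) · max_{D₀ ≤ t ≤ D₁} |∑_{D₀ < i ≤ t} c(i)|`.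
[folklore] -/
theorem abs_sum_Ioc_mul_le_of_antitone {u c : ℕ → ℝ} {D₀ D₁ : ℕ} (hD : D₀ ≤ D₁)
    (hu : ∀ i, D₀ < i → i < D₁ → u (i + 1) ≤ u i) (hu0 : 0 ≤ u D₁) (hu1 : 0 ≤ u (D₀ + 1))
    {M : ℝ}
    (hM : ∀ t, D₀ ≤ t → t ≤ D₁ → |∑ i ∈ Ioc D₀ t, c i| ≤ M) :
    |∑ i ∈ Ioc D₀ D₁, u i * c i| ≤ u (D₀ + 1) * M := by
  have hM0 : 0 ≤ M := (abs_nonneg _).trans (hM D₀ le_rfl hD)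
  rcases hD.eq_or_lt with h | hlt
  · subst h; simp only [Finset.Ioc_self, Finset.sum_empty, abs_zero]
    positivity
  -- antitone consequences
  have hmono : ∀ i j, D₀ < i → i ≤ j → j ≤ D₁ → u j ≤ u i := by
    intro i j hi hij hj
    induction j, hij using Nat.le_induction with
    | base => exact le_rfl
    | succ j hij ih => exact (hu j (by omega) (by omega)).trans (ih (by omega))
  -- the Abel recursion: `A(n) = u(n) S(n) + R(n)`, `|R(n)| ≤ (u(D₀+1) - u(n)) M`
  have key : ∀ n, D₀ + 1 ≤ n → n ≤ D₁ → ∃ R : ℝ,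
      ∑ i ∈ Ioc D₀ n, u i * c i = u n * ∑ i ∈ Ioc D₀ n, c i + R ∧
        |R| ≤ (u (D₀ + 1) - u n) * M := by
    intro n hn hnD
    induction n, hn using Nat.le_induction with
    | base =>
      refine ⟨0, ?_, by simp⟩
      have : Ioc D₀ (D₀ + 1) = {D₀ + 1} := by
        ext i; simp only [Finset.mem_Ioc, Finset.mem_singleton]; omega
      simp [this]
    | succ n hn ih =>
      obtain ⟨R, hR, hRb⟩ := ih (by omega)
      refine ⟨R + (u n - u (n + 1)) * ∑ i ∈ Ioc D₀ n, c i, ?_, ?_⟩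
      · rw [Finset.sum_Ioc_succ_top (by omega), hR, Finset.sum_Ioc_succ_top (by omega)]
        ring
      · have h1 : u (n + 1) ≤ u n := hu n (by omega) (by omega)
        calc |R + (u n - u (n + 1)) * ∑ i ∈ Ioc D₀ n, c i|
            ≤ |R| + |(u n - u (n + 1)) * ∑ i ∈ Ioc D₀ n, c i| := abs_add_le _ _
          _ ≤ (u (D₀ + 1) - u n) * M + (u n - u (n + 1)) * M := by
              refine add_le_add hRb ?_
              rw [abs_mul, abs_of_nonneg (by linarith)]
              exact mul_le_mul_of_nonneg_left (hM n (by omega) (by omega)) (by linarith)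
          _ = (u (D₀ + 1) - u (n + 1)) * M := by ring
  obtain ⟨R, hR, hRb⟩ := key D₁ hlt le_rfl
  rw [hR]
  have huD : u D₁ ≤ u (D₀ + 1) := hmono (D₀ + 1) D₁ (by omega) hlt le_rfl
  calc |u D₁ * ∑ i ∈ Ioc D₀ D₁, c i + R| ≤ |u D₁ * ∑ i ∈ Ioc D₀ D₁, c i| + |R| := abs_add_le _ _
    _ ≤ u D₁ * M + (u (D₀ + 1) - u D₁) * M := by
        refine add_le_add ?_ hRb
        rw [abs_mul, abs_of_nonneg hu0]
        exact mul_le_mul_of_nonneg_left (hM D₁ hD le_rfl) hu0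
    _ = u (D₀ + 1) * M := by ring

/-! ### Residue classes modulo `W` -/

/-- A residue coprime to `W ≥ 2` is nonzero, hence in `[1, W-1]`. [folklore] -/
theorem one_le_mod_of_coprime {n W : ℕ} (hW : 2 ≤ W) (h : Nat.Coprime n W) : 1 ≤ n % W := by
  rw [Nat.one_le_iff_ne_zero]
  intro h0
  have : Nat.Coprime (n % W) W := (ZMod.coprime_mod_iff_coprime n W).mpr h
  rw [h0, Nat.coprime_zero_left] at this
  omega

/-- **Splitting a sum over the integers of `(s, t]` coprime to `W` into residue classes**:
with `n = W d + b`, `b = n mod W`, the classes are `b ∈ [0, W)` coprime to `W` and, in the class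
of `b`, `d` ranges over `((s-b)/W, (t-b)/W]` (integer division; `W ≤ s ≤ t`). [folklore] -/
theorem sum_filter_coprime_Ioc_eq {W : ℕ} (hW : 1 ≤ W) {s t : ℕ} (hWs : W ≤ s) (hst : s ≤ t)
    (Φ : ℕ → ℝ) :
    ∑ n ∈ (Ioc s t).filter (fun n => Nat.Coprime n W), Φ n =
      ∑ b ∈ (Finset.range W).filter (fun b => Nat.Coprime b W),
        ∑ d ∈ Ioc ((s - b) / W) ((t - b) / W), Φ (W * d + b) := by
  have hW0 : 0 < W := hW
  rw [← Finset.sum_fiberwise_of_maps_to (g := fun n => n % W)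
    (t := (Finset.range W).filter fun b => Nat.Coprime b W) (fun n hn => by
      rw [Finset.mem_filter] at hn ⊢
      exact ⟨Finset.mem_range.mpr (Nat.mod_lt _ hW0), (ZMod.coprime_mod_iff_coprime n W).mpr hn.2⟩)]
  refine Finset.sum_congr rfl fun b hb => ?_
  rw [Finset.mem_filter, Finset.mem_range] at hb
  obtain ⟨hbW, hbcop⟩ := hb
  have hbs : b ≤ s := by omega
  symm
  refine Finset.sum_nbij' (fun d => W * d + b) (fun n => n / W) ?_ ?_ ?_ ?_ ?_
  · intro d hd
    rw [Finset.mem_Ioc] at hd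
    rw [Finset.mem_filter, Finset.mem_filter, Finset.mem_Ioc]
    refine ⟨⟨⟨?_, ?_⟩, ?_⟩, ?_⟩
    · -- `s < W d + b` from `(s - b)/W < d`
      have h1 : s - b < W * ((s - b) / W) + W := Nat.lt_div_mul_add (by omega) |>.trans_eq (by ring)
      have h2 : W * ((s - b) / W) + W ≤ W * d := by
        have : (s - b) / W + 1 ≤ d := hd.1
        nlinarith
      omega
    · -- `W d + b ≤ t` from `d ≤ (t - b)/W`
      have h1 : W * d ≤ W * ((t - b) / W) := Nat.mul_le_mul_left W hd.2
      have h2 : W * ((t - b) / W) ≤ t - b := Nat.mul_div_le (t - b) W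
      omega
    · rw [Nat.coprime_mul_left_add_left]; exact hbcop
    · rw [Nat.mul_add_mod_self_left, Nat.mod_eq_of_lt hbW]
  · intro n hn
    rw [Finset.mem_filter, Finset.mem_filter, Finset.mem_Ioc] at hn
    obtain ⟨⟨⟨hsn, hnt⟩, _⟩, hnb⟩ := hn
    rw [Finset.mem_Ioc]
    have hn' : n = W * (n / W) + b := by rw [← hnb]; exact (Nat.div_add_mod n W).symm
    constructor
    · -- `(s - b)/W < n / W`
      by_contra hle
      have hle' : n / W ≤ (s - b) / W := Nat.le_of_not_lt hle
      have h1 : W * (n / W) ≤ W * ((s - b) / W) := Nat.mul_le_mul_left W hle'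
      have h2 : W * ((s - b) / W) ≤ s - b := Nat.mul_div_le (s - b) W
      omega
    · -- `n / W ≤ (t - b)/W`
      refine (Nat.le_div_iff_mul_le hW0).mpr ?_
      have : n / W * W = W * (n / W) := by ring
      omega
  · intro d _
    show (W * d + b) / W = d
    rw [Nat.add_comm, Nat.add_mul_div_left _ _ hW0, Nat.div_eq_of_lt hbW, zero_add]
  · intro n hn
    rw [Finset.mem_filter] at hn
    show W * (n / W) + b = n
    rw [← hn.2]; exact Nat.div_add_mod n W
  · intro d _
    rfl

/-- The class of `b` in `(s, t]` has at least `(t - s)/W` members. [folklore] -/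
theorem card_Ioc_div_ge {W s t b : ℕ} (hbs : b ≤ s) (hst : s ≤ t) :
    (t - s) / W ≤ (Ioc ((s - b) / W) ((t - b) / W)).card := by
  rw [Nat.card_Ioc]
  have : (s - b) / W + (t - s) / W ≤ (t - b) / W := by
    have h := Nat.add_div_le_add_div (s - b) (t - s) W
    have heq : s - b + (t - s) = t - b := by omega
    rwa [heq] at h
  omega

/-- Primes above `w` are coprime to `W = ∏_{p ≤ w} p`. [folklore] -/
theorem coprime_primorial_of_lt {p w : ℕ} (hp : p.Prime) (hw : w < p) :
    Nat.Coprime p (primorial w) :=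
  (Nat.Prime.coprime_iff_not_dvd hp).mpr fun h => absurd (hp.dvd_primorial_iff.mp h) (not_le.mpr hw)

/-! ### The `W`-tricked von Mangoldt weight -/

/-- `0 ≤ Λ'_{b,W}(d) ≤ log(W d + b)`. [folklore] -/
theorem vonMangoldtW_nonneg_le (W b d : ℕ) :
    0 ≤ vonMangoldtW W b d ∧ vonMangoldtW W b d ≤ Real.log (W * d + b : ℕ) := by
  unfold vonMangoldtW
  have h1 := (vonMangoldtPrime_le_vonMangoldt (W * d + b)).1
  have h2 : (Nat.totient W : ℝ) / W ≤ 1 := by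
    rcases Nat.eq_zero_or_pos W with hW | hW
    · simp [hW]
    · rw [div_le_one (by exact_mod_cast hW)]; exact_mod_cast Nat.totient_le W
  have h3 : (0 : ℝ) ≤ (Nat.totient W : ℝ) / W := by positivity
  refine ⟨mul_nonneg h3 h1, ?_⟩
  calc (Nat.totient W : ℝ) / W * vonMangoldtPrime (W * d + b) ≤ 1 * vonMangoldtPrime (W * d + b) :=
        mul_le_mul_of_nonneg_right h2 h1
    _ ≤ Real.log (W * d + b : ℕ) := by
        rw [one_mul]
        exact (vonMangoldtPrime_le_vonMangoldt _).2.trans ArithmeticFunction.vonMangoldt_le_log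

/-- `∑_{d=1}^{H} |Λ'_{b,W}(d) - 1| ≤ H (1 + log (W (H+1)))` for `b ≤ W`, `W ≥ 1`. [folklore] -/
theorem sum_abs_vonMangoldtW_sub_one_le {W b H : ℕ} (hW : 1 ≤ W) (hb : b ≤ W) :
    ∑ d ∈ Icc 1 H, |vonMangoldtW W b d - 1| ≤ H * (1 + Real.log ((W * (H + 1) : ℕ) : ℝ)) := by
  have hcard : ((Icc 1 H).card : ℝ) = H := by simp
  rw [← hcard, ← nsmul_eq_mul, ← Finset.sum_const]
  refine Finset.sum_le_sum fun d hd => ?_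
  rw [Finset.mem_Icc] at hd
  obtain ⟨h0, hle⟩ := vonMangoldtW_nonneg_le W b d
  have hlog : Real.log ((W * d + b : ℕ) : ℝ) ≤ Real.log ((W * (H + 1) : ℕ) : ℝ) := by
    apply Real.log_le_log (by exact_mod_cast (show 0 < W * d + b by nlinarith [hd.1]))
    exact_mod_cast (show W * d + b ≤ W * (H + 1) by nlinarith)
  rw [abs_le]; constructor <;> linarith

/-- **The von Mangoldt weight in residue classes**: `Λ'(n) = (W/φ(W)) Λ'_{n mod W, W}(⌊n/W⌋)`
(`W ≥ 1`). [cite: GreenTao2010, (5.1)] -/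
theorem vonMangoldtPrime_eq_mul_vonMangoldtW {W : ℕ} (hW : 1 ≤ W) (n : ℕ) :
    vonMangoldtPrime n = (W : ℝ) / Nat.totient W * vonMangoldtW W (n % W) (n / W) := by
  unfold vonMangoldtW
  have hφ : (0 : ℝ) < Nat.totient W := by exact_mod_cast Nat.totient_pos.mpr hW
  have hW0 : (0 : ℝ) < W := by exact_mod_cast hW
  rw [Nat.div_add_mod n W]
  field_simp

/-! ### The error functional `E(F) = ∑_{n ∈ I_W} F(n) (Λ'_{b(n),W}(d(n)) - 1)/n` -/

/-- **The key estimate behind Theorem 3.2**: if all flat sums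
`∑_{d=1}^{H} (Λ'_{b,W}(d) - 1) F(Wd+b)` with `(s-b)/W ≤ H ≤ (2s-b)/W` are at most `τ s/W` in size,
then `|∑_{n ∈ (s,2s], (n,W)=1} F(n)(Λ'_{n mod W,W}(⌊n/W⌋) - 1)/n| ≤ 8τ ∑_{n ∈ (s,2s], (n,W)=1} 1/n`
(`W ≥ 2`, `s ≥ 2W`): Abel summation in `n`, the residue decomposition, and the lower
bound `∑_{n ∈ (s,2s], (n,W)=1} 1/n ≥ #residues/(4W)`.
[cite: TaoTeravainenJTNB2018, §5 (proof of Theorem 3.2: "Partitioning into residue classes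
modulo `W`" and "By summation by parts")] -/
theorem abs_errorSum_le {W : ℕ} (hW : 2 ≤ W) {s : ℕ} (hs : 2 * W ≤ s) (F : ℕ → ℝ)
    {τ : ℝ} (hτ : 0 ≤ τ)
    (hT : ∀ b ∈ (Finset.range W).filter (fun b => Nat.Coprime b W), ∀ H : ℕ,
      (s - b) / W ≤ H → H ≤ (2 * s - b) / W →
        |∑ d ∈ Icc 1 H, (vonMangoldtW W b d - 1) * F (W * d + b)| ≤ τ * (s / W : ℝ)) :
    |∑ n ∈ (Ioc s (2 * s)).filter (fun n => Nat.Coprime n W),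
        F n * (vonMangoldtW W (n % W) (n / W) - 1) / n| ≤
      8 * τ * ∑ n ∈ (Ioc s (2 * s)).filter (fun n => Nat.Coprime n W), (1 : ℝ) / n := by
  have hW1 : 1 ≤ W := by omega
  have hW0 : (0 : ℝ) < W := by exact_mod_cast (show 0 < W by omega)
  have hs0 : (0 : ℝ) < s := by exact_mod_cast (show 0 < s by omega)
  set Rset := (Finset.range W).filter (fun b => Nat.Coprime b W) with hRset
  set R : ℝ := (Rset.card : ℝ) with hRdef
  -- (c) the lower bound for the harmonic weight of `I_W`
  have hD : R / (4 * W) ≤ ∑ n ∈ (Ioc s (2 * s)).filter (fun n => Nat.Coprime n W), (1 : ℝ) / n := by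
    rw [sum_filter_coprime_Ioc_eq hW1 (by omega) (by omega) (fun n => (1 : ℝ) / n)]
    have hbound : ∀ b ∈ Rset, (1 : ℝ) / (4 * W) ≤
        ∑ d ∈ Ioc ((s - b) / W) ((2 * s - b) / W), (1 : ℝ) / ((W * d + b : ℕ) : ℝ) := by
      intro b hb
      simp only [hRset, Finset.mem_filter, Finset.mem_range] at hb
      have hcard := card_Ioc_div_ge (W := W) (b := b) (show b ≤ s by omega) (show s ≤ 2 * s by omega)
      have hcnt : (s : ℝ) / (2 * W) ≤ ((Ioc ((s - b) / W) ((2 * s - b) / W)).card : ℝ) := by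
        have h1 : ((2 * s - s) / W : ℕ) = s / W := by rw [show 2 * s - s = s by omega]
        rw [h1] at hcard
        have h2 : ((s / W : ℕ) : ℝ) ≤ (Ioc ((s - b) / W) ((2 * s - b) / W)).card := by
          exact_mod_cast hcard
        refine le_trans ?_ h2
        -- `s/(2W) ≤ ⌊s/W⌋` since `⌊s/W⌋ ≥ s/W - 1 ≥ s/(2W)` (`s ≥ 2W`)
        have h3 : ((s / W : ℕ) : ℝ) ≥ (s : ℝ) / W - 1 := by
          have := Nat.div_add_mod s W
          have h4 : (s : ℝ) = W * (s / W : ℕ) + (s % W : ℕ) := by exact_mod_cast this.symm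
          have h5 : ((s % W : ℕ) : ℝ) < W := by exact_mod_cast Nat.mod_lt s (by omega)
          rw [ge_iff_le, sub_le_iff_le_add, div_le_iff₀ hW0]
          nlinarith
        have h6 : (2 * W : ℝ) ≤ s := by exact_mod_cast hs
        rw [div_le_iff₀ (by positivity)]
        rw [ge_iff_le, sub_le_iff_le_add, div_le_iff₀ hW0] at h3
        nlinarith
      -- each term is at least `1/(2s)`
      have hterm : ∀ d ∈ Ioc ((s - b) / W) ((2 * s - b) / W),
          (1 : ℝ) / (2 * s) ≤ 1 / ((W * d + b : ℕ) : ℝ) := by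
        intro d hd
        rw [Finset.mem_Ioc] at hd
        have h1 : W * d ≤ W * ((2 * s - b) / W) := Nat.mul_le_mul_left W hd.2
        have h2 : W * ((2 * s - b) / W) ≤ 2 * s - b := Nat.mul_div_le _ W
        have h3' : W * d + b ≤ 2 * s := by
          have hb2 : b ≤ 2 * s := by omega
          calc W * d + b ≤ W * ((2 * s - b) / W) + b := Nat.add_le_add_right h1 b
            _ ≤ (2 * s - b) + b := Nat.add_le_add_right h2 b
            _ = 2 * s := Nat.sub_add_cancel hb2
        have h3 : ((W * d + b : ℕ) : ℝ) ≤ 2 * s := by exact_mod_cast h3'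
        have h4 : (0 : ℝ) < ((W * d + b : ℕ) : ℝ) := by
          have hd1 : 1 ≤ d := Nat.lt_of_le_of_lt (Nat.zero_le _) hd.1
          exact_mod_cast Nat.add_pos_left (Nat.mul_pos (by omega) hd1) b
        exact one_div_le_one_div_of_le h4 h3
      calc (1 : ℝ) / (4 * W) = (s / (2 * W)) * (1 / (2 * s)) := by field_simp; ring
        _ ≤ ((Ioc ((s - b) / W) ((2 * s - b) / W)).card : ℝ) * (1 / (2 * s)) :=
            mul_le_mul_of_nonneg_right hcnt (by positivity)
        _ = ∑ d ∈ Ioc ((s - b) / W) ((2 * s - b) / W), (1 : ℝ) / (2 * s) := by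
            rw [Finset.sum_const, nsmul_eq_mul]
        _ ≤ _ := Finset.sum_le_sum hterm
    calc R / (4 * W) = ∑ b ∈ Rset, (1 : ℝ) / (4 * W) := by
          rw [Finset.sum_const, nsmul_eq_mul, hRdef]; ring
      _ ≤ _ := Finset.sum_le_sum fun b hb => by
          refine (hbound b hb).trans (le_of_eq (Finset.sum_congr rfl fun d _ => ?_))
          push_cast; ring
  -- (a) Abel summation in `n`
  set c : ℕ → ℝ := fun n => if Nat.Coprime n W then F n * (vonMangoldtW W (n % W) (n / W) - 1) else 0
    with hcdef
  have hsumc : ∑ n ∈ (Ioc s (2 * s)).filter (fun n => Nat.Coprime n W),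
      F n * (vonMangoldtW W (n % W) (n / W) - 1) / n = ∑ n ∈ Ioc s (2 * s), (1 / (n : ℝ)) * c n := by
    rw [Finset.sum_filter]
    refine Finset.sum_congr rfl fun n _ => ?_
    simp only [hcdef]
    split_ifs <;> ring
  -- partial sums of `c` over `(s, t]` via residues
  have hpartial : ∀ t, s ≤ t → t ≤ 2 * s → |∑ n ∈ Ioc s t, c n| ≤ R * (2 * (τ * (s / W))) := by
    intro t hst ht2
    have h1 : ∑ n ∈ Ioc s t, c n =
        ∑ n ∈ (Ioc s t).filter (fun n => Nat.Coprime n W),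
          F n * (vonMangoldtW W (n % W) (n / W) - 1) := by
      rw [Finset.sum_filter]
    rw [h1, sum_filter_coprime_Ioc_eq hW1 (by omega) hst]
    refine (Finset.abs_sum_le_sum_abs _ _).trans ?_
    rw [hRdef, ← nsmul_eq_mul, ← Finset.sum_const]
    refine Finset.sum_le_sum fun b hb => ?_
    have hb' := hb
    simp only [Finset.mem_filter, Finset.mem_range] at hb'
    -- simplify `(W d + b) % W = b`, `(W d + b)/W = d`
    have hsimp : ∀ d, F (W * d + b) * (vonMangoldtW W ((W * d + b) % W) ((W * d + b) / W) - 1) =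
        (vonMangoldtW W b d - 1) * F (W * d + b) := by
      intro d
      rw [Nat.mul_add_mod_self_left, Nat.mod_eq_of_lt hb'.1, Nat.add_comm,
        Nat.add_mul_div_left _ _ (by omega), Nat.div_eq_of_lt hb'.1, zero_add, mul_comm]
    simp_rw [hsimp]
    -- the window sum is a difference of two flat sums
    set A := (s - b) / W with hA
    set Bt := (t - b) / W with hBt
    have hAB : A ≤ Bt := Nat.div_le_div_right (by omega)
    have hflat : ∑ d ∈ Ioc A Bt, (vonMangoldtW W b d - 1) * F (W * d + b) =
        ∑ d ∈ Icc 1 Bt, (vonMangoldtW W b d - 1) * F (W * d + b) -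
          ∑ d ∈ Icc 1 A, (vonMangoldtW W b d - 1) * F (W * d + b) := by
      have := Finset.sum_Ioc_consecutive (fun d => (vonMangoldtW W b d - 1) * F (W * d + b))
        (Nat.zero_le A) hAB
      rw [← Finset.Icc_add_one_left_eq_Ioc 0 A, ← Finset.Icc_add_one_left_eq_Ioc 0 Bt,
        zero_add] at this
      linarith
    rw [hflat]
    have hBt2 : Bt ≤ (2 * s - b) / W := Nat.div_le_div_right (by omega)
    have h2 := hT b hb Bt hAB hBt2
    have h3 := hT b hb A le_rfl (hAB.trans hBt2)
    calc |∑ d ∈ Icc 1 Bt, (vonMangoldtW W b d - 1) * F (W * d + b) -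
          ∑ d ∈ Icc 1 A, (vonMangoldtW W b d - 1) * F (W * d + b)|
        ≤ |∑ d ∈ Icc 1 Bt, (vonMangoldtW W b d - 1) * F (W * d + b)| +
          |∑ d ∈ Icc 1 A, (vonMangoldtW W b d - 1) * F (W * d + b)| := abs_sub _ _
      _ ≤ τ * (s / W) + τ * (s / W) := add_le_add h2 h3
      _ = 2 * (τ * (s / W)) := by ring
  have habel := abs_sum_Ioc_mul_le_of_antitone (u := fun n => 1 / (n : ℝ)) (c := c)
    (show s ≤ 2 * s by omega) (fun i hi _ => by
      show 1 / ((i + 1 : ℕ) : ℝ) ≤ 1 / (i : ℝ)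
      have : (0 : ℝ) < i := by exact_mod_cast (show 0 < i by omega)
      exact one_div_le_one_div_of_le this (by push_cast; linarith))
    (by positivity) (by positivity) hpartial
  rw [hsumc]
  refine habel.trans ?_
  -- (d) `u(s+1) M ≤ 2τR/W = 8τ · R/(4W) ≤ 8τ D`
  have hu : (1 : ℝ) / ((s + 1 : ℕ) : ℝ) ≤ 1 / s :=
    one_div_le_one_div_of_le hs0 (by push_cast; linarith)
  calc (1 : ℝ) / ((s + 1 : ℕ) : ℝ) * (R * (2 * (τ * (s / W))))
      ≤ 1 / s * (R * (2 * (τ * (s / W)))) :=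
        mul_le_mul_of_nonneg_right hu (by rw [hRdef]; positivity)
    _ = 8 * τ * (R / (4 * W)) := by field_simp; ring
    _ ≤ 8 * τ * ∑ n ∈ (Ioc s (2 * s)).filter (fun n => Nat.Coprime n W), (1 : ℝ) / n :=
        mul_le_mul_of_nonneg_left hD (by positivity)

end OddLogChowla

end Literature.NumberTheory.Sieve
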